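import Summits.BirchSwinnertonDyer.Rank1Residual.X11b.AnticyclotomicLevelStructure
import Summits.BirchSwinnertonDyer.Rank1Residual.X11b.AnticyclotomicInfinitePlaces
import Summits.BirchSwinnertonDyer.Rank1Residual.X11b.PoitouTateSelmerCounting
import HarnessLib

/-!
# X11b, route R1 — the propagated Castella structure `𝓛^{(k)}` on `E[p^k]` at the remaining
# places (complex places, `𝔭` under (iv), the other places above `p`, `Σ`) and their DUAL conditions

HONEST FRAMING (cell `b2b-bsdres`, run/shared/lean/b2b/bsd-rank1-residual/, verbatim in every
file): the goal of the cell is to DELETE the COMBINATION-SHAPED residual classes of the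
Birch–Swinnerton-Dyer formula for ALL analytic-rank `≤ 1` elliptic curves over `ℚ` — "full BSD
formula for every rank `≤ 1` curve in class `C`" assembled STRICTLY from published theorems — so
that the rank-`≤ 1` remainder becomes exactly the CONSTRUCTION-SHAPED classes, which are TYPED
(missing-input `Prop`s), NOT attempted. This is not "finishing BSD". Sub-cell
`b2b-bsdres-multr1-p1` (X11b, route R1 = Castella 2018 Thm. A re-proved along the author's
erratum); a RESEARCH ROUTE; no claim beyond the stated class; X11b stays CONSTRUCTION-SHAPED;
nothing here changes a label; no named fact is minted (theorems only; no `sorry`).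

## What is here (towards step (e) of REPORT §24)

With the companion `PropagatedUnramified` (at good `v ∤ p` outside `Σ` the condition of
`𝓛^{(k)} = acLevelStructure W p k 𝔭 Σ` is `H¹_ur`), the local conditions of `𝓛^{(k)}` and of its
DUAL structure `(𝓛^{(k)})^*` (`LocalInvariants.dualSelmerStructure`, Howard Def. 2.1.6/2.1.10) are
now explicit at every place except the finitely many bad `v ∤ p` and `v ∈ Σ`:

* complex places: `H¹(K_w, M) = 0` for EVERY discrete Galois module — `Γ_{K_w}` is trivial
  (`subsingleton_galoisCohomology_toLocal_inl_of_isComplex`, `localization_inl_eq_zero_of_isComplex`);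
  so for totally complex `K` (route R1: `K` imaginary quadratic) every local condition and every
  dual condition at infinity is both `⊥` and `⊤`;
* at `𝔭` under the erratum's hypothesis (iv) in the form "`E[p^∞]` has no `Γ_{K_𝔭}`-invariants":
  `𝓛^{(k)}_𝔭 = ⊥` (`acLevelStructure_self_eq_bot_of_noInvariants`: the propagated strict condition
  is the kernel of an injective map), hence `(𝓛^{(k)})^*_𝔭 = ⊤` (`dualLocalCondition_bot`);
* at a place `v ∣ p`, `v ≠ 𝔭` (for `p = 𝔭𝔭̄` split: at `𝔭̄`) and at `v ∈ Σ`, `v ≠ 𝔭`: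
  `𝓛^{(k)}_v = ⊤`, hence `(𝓛^{(k)})^*_v = ⊥` for a perfect family (`dualLocalCondition_top`).

So the dual structure is: relaxed at `𝔭`, STRICT at `𝔭̄` and on `Σ`, unramified at good `v ∤ p`
outside `Σ` (`UnramifiedOrthogonal`), i.e. — up to the Weil self-duality `E[p^k]^D ≅ E[p^k]` and
the dual conditions at the bad `v ∤ p` (successor work) — the propagated Castella structure for the
CONJUGATE prime `𝔭̄` with `Σ = ∅` made strict on `Σ`: `H¹_{(𝓛^{(k)})^*} ↪ Sel_𝔭̄(K, E[p^∞])`, the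
group whose finiteness drives the level-shifting argument for `LevelLiftingAt` (JSW17 Prop. 3.3.2:
"`H¹_{(F_ac^S)_v̄}(K, T) = 0`").

References: [Howard2004HeegnerKolyvagin] Def. 2.1.6, Def. 2.1.10; [Castella2018] Def. 2.2;
[JetchevSkinnerWan2017] §2.2.3, Prop. 3.3.2 (proof); [GreenbergLNM1716] §3 p. 87 (archimedean
primes).
-/

noncomputable section

open scoped Classical

open CategoryTheory Field NumberField IsDedekindDomain
open Literature.NumberTheory.EllipticCurves Literature.NumberTheory.EllipticCurves.GreenbergSelmer
open Literature.NumberTheory.GaloisRepresentations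
open Literature.NumberTheory.GaloisRepresentations.DiscreteGaloisModule (SelmerStructure)
open Literature.NumberTheory.GaloisCohomology
open scoped ContRepresentation

/-! ## §1. Complex places: `H¹(K_w, M) = 0` -/

namespace Summit.BirchSwinnertonDyer.Rank1Residual.X11b.LocBridge

section Complex

variable {K : Type} [Field K] [NumberField K] {M : Type} [AddCommGroup M] [TopologicalSpace M]
  [DiscreteTopology M] (ρ : DiscreteGaloisModule K M)

/-- **At a complex place `w`, `H¹(K_w, M) = 0` for every discrete Galois module**: `K_w ≃ ℂ` is
algebraically closed, so `Γ_{K_w}` is trivial (`AcSelmer.subsingleton_absoluteGaloisGroup_of_isAlgClosed`)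
and every continuous crossed homomorphism vanishes (`φ(1) = 0`).
[cite: GreenbergLNM1716, §3 p. 87 (archimedean primes split completely)] -/
theorem subsingleton_galoisCohomology_toLocal_inl_of_isComplex {w : InfinitePlace K}
    (hw : w.IsComplex) : Subsingleton (galoisCohomology (ρ.toLocal (Sum.inl w)) 1) := by
  haveI : IsAlgClosed w.Completion :=
    IsAlgClosed.of_ringEquiv ℂ w.Completion
      (InfinitePlace.Completion.ringEquivComplexOfIsComplex hw).symm
  haveI : Subsingleton (absoluteGaloisGroup (Place.Completion (Sum.inl w : Place K))) :=
    AcSelmer.subsingleton_absoluteGaloisGroup_of_isAlgClosed w.Completion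
  refine ⟨fun a b ↦ ?_⟩
  obtain ⟨φ, rfl⟩ := oneCocycleClass_surjective _ a
  obtain ⟨ψ, rfl⟩ := oneCocycleClass_surjective _ b
  congr 1
  refine Subtype.ext (ContinuousMap.ext fun σ ↦ ?_)
  rw [Subsingleton.elim σ 1, contOneCocycles.apply_one, contOneCocycles.apply_one]

/-- Hence every localisation at a complex place vanishes. [cite: GreenbergLNM1716, §3 p. 87] -/
theorem localization_inl_eq_zero_of_isComplex {w : InfinitePlace K} (hw : w.IsComplex)
    (c : galoisCohomology ρ 1) : galoisCohomology.localization ρ (Sum.inl w) 1 c = 0 :=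
  haveI := subsingleton_galoisCohomology_toLocal_inl_of_isComplex ρ hw
  Subsingleton.elim _ _

/-- … and every local condition at a complex place is `⊤` (and `⊥`). [folklore] -/
theorem eq_top_of_isComplex {w : InfinitePlace K} (hw : w.IsComplex)
    (L : AddSubgroup (galoisCohomology (ρ.toLocal (Sum.inl w)) 1)) : L = ⊤ :=
  haveI := subsingleton_galoisCohomology_toLocal_inl_of_isComplex ρ hw
  eq_top_iff.mpr fun x _ ↦ by rw [Subsingleton.elim x 0]; exact L.zero_mem

end Complex

end Summit.BirchSwinnertonDyer.Rank1Residual.X11b.LocBridge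

/-! ## §2. `𝓛^{(k)}` at `𝔭`, at the other places above `p`, and on `Σ`; the dual conditions there -/

namespace Summit.BirchSwinnertonDyer.Rank1Residual.X11b.AcSelmer

open Summit.BirchSwinnertonDyer.Rank1Residual.X11b.LocBridge
open Summit.BirchSwinnertonDyer.Rank1Residual.X11b.Levels

variable {K : Type} [Field K] [NumberField K] (W : WeierstrassCurve K) (p k : ℕ)
  (𝔭 : HeightOneSpectrum (𝓞 K)) (S : Set (HeightOneSpectrum (𝓞 K)))

/-- **At `𝔭`, `𝓛^{(k)}_𝔭 = 0` when `E[p^∞]` has no `Γ_{K_𝔭}`-invariant point** (the erratum's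
hypothesis (iv) `E(K_𝔭)[p] = 0`, `K_𝔭 = ℚ_p`): the propagated STRICT condition is the kernel of
`H¹(K_𝔭, E[p^k]) → H¹(K_𝔭, E[p^∞])`, injective without invariants
(`map_primaryInclusion_restrictField_injective`). [cite: Castella2018, Def. 2.2 (arXiv:1704.06608 p. 5)]
[cite: JetchevSkinnerWan2017, §2.2.3 (arXiv:1512.06894 p. 6)] -/
theorem acLevelStructure_self_eq_bot_of_noInvariants
    (hΓ : ∀ Q : W.geomPrimaryTorsion p,
      (∀ σ : absoluteGaloisGroup (𝔭.adicCompletion K),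
        GaloisRep.restrictField (𝔭.adicCompletion K) (primaryGaloisModule W p) σ Q = Q) → Q = 0) :
    acLevelStructure W p k 𝔭 S (Sum.inr 𝔭) = ⊥ := by
  rw [acLevelStructure_eq_ker_of W p k 𝔭 S (acStructure_self (primaryGaloisModule W p) p 𝔭 S),
    eq_bot_iff]
  intro c hc
  rw [AddSubgroup.mem_bot]
  have hc' : galoisCohomology.map
      ((primaryInclusion W p k).restrictField (𝔭.adicCompletion K)) 1 c = 0 := hc
  exact map_primaryInclusion_restrictField_injective W p k (𝔭.adicCompletion K) hΓ
    (hc'.trans (map_zero _).symm)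

/-- At a place `v ∣ p` other than `𝔭` (for `p = 𝔭𝔭̄` split: at `𝔭̄`), `𝓛^{(k)}_v = ⊤` (relaxed).
[cite: Castella2018, Def. 2.2 (arXiv:1704.06608 p. 5)] -/
theorem acLevelStructure_eq_top_of_mem_of_ne {v : HeightOneSpectrum (𝓞 K)}
    (hv : ((p : ℕ) : 𝓞 K) ∈ v.asIdeal) (hne : v ≠ 𝔭) : acLevelStructure W p k 𝔭 S (Sum.inr v) = ⊤ :=
  acLevelStructure_eq_top_of W p k 𝔭 S (acStructure_of_mem_of_ne (primaryGaloisModule W p) p 𝔭 S hv hne)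

/-- At a place of `Σ` other than `𝔭`, `𝓛^{(k)}_v = ⊤` (`Σ`-imprimitive).
[cite: Castella2018, Def. 2.2 (arXiv:1704.06608 p. 5)] -/
theorem acLevelStructure_eq_top_of_mem_S {v : HeightOneSpectrum (𝓞 K)} (hvS : v ∈ S)
    (hne : v ≠ 𝔭) : acLevelStructure W p k 𝔭 S (Sum.inr v) = ⊤ :=
  acLevelStructure_eq_top_of W p k 𝔭 S (acStructure_of_mem_S (primaryGaloisModule W p) p 𝔭 S hvS hne)

/-- At a complex place, `𝓛^{(k)}_w = ⊤` (nothing to impose: `H¹(K_w, ·) = 0`).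
[cite: GreenbergLNM1716, §3 p. 87] -/
theorem acLevelStructure_inl_eq_top_of_isComplex {w : InfinitePlace K} (hw : w.IsComplex) :
    acLevelStructure W p k 𝔭 S (Sum.inl w) = ⊤ :=
  eq_top_of_isComplex _ hw _

/-! ### The dual local conditions at these places (Howard Def. 2.1.6) -/

variable {n : ℕ} (inv : LocalInvariants K n)

omit [NumberField K] in
/-- `E[p^k]` is finite for an elliptic curve (char. `0`) — the instance argument of the dual
statements below (supply with `haveI`). [folklore] -/
theorem finite_geomTorsion_pow [W.IsElliptic] [Fact p.Prime] : Finite (W.geomTorsion ((p ^ k : ℕ) : ℤ)) :=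
  W.finite_torsionPoints_holds (AlgebraicClosure K)
    (by exact_mod_cast pow_ne_zero k (Fact.out : p.Prime).ne_zero)

variable [Finite (W.geomTorsion ((p ^ k : ℕ) : ℤ))]

/-- **`(𝓛^{(k)})^*_𝔭 = ⊤` under (iv)**: the dual of the strict condition is the relaxed one
(`dualLocalCondition_bot`). [cite: Howard2004HeegnerKolyvagin, Def. 2.1.6 (arXiv:1202.6340 p. 5)] -/
theorem dualSelmerStructure_acLevelStructure_self_eq_top
    (hΓ : ∀ Q : W.geomPrimaryTorsion p,
      (∀ σ : absoluteGaloisGroup (𝔭.adicCompletion K),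
        GaloisRep.restrictField (𝔭.adicCompletion K) (primaryGaloisModule W p) σ Q = Q) → Q = 0) :
    inv.dualSelmerStructure (W.torsionGaloisModule ((p ^ k : ℕ) : ℤ))
        (acLevelStructure W p k 𝔭 S) (Sum.inr 𝔭) = ⊤ := by
  rw [LocalInvariants.dualSelmerStructure_apply,
    acLevelStructure_self_eq_bot_of_noInvariants W p k 𝔭 S hΓ]
  exact LocalInvariants.dualLocalCondition_bot inv _ _

/-- **`(𝓛^{(k)})^*_v = ⊥` at a place `v ∣ p`, `v ≠ 𝔭`** (for a perfect family at level `n` with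
`n · E[p^k] = 0`): the dual of the relaxed condition is the strict one
(`PoitouTateCounting.dualLocalCondition_top`). [cite: Howard2004HeegnerKolyvagin, Def. 2.1.6 (arXiv:1202.6340 p. 5)] -/
theorem dualSelmerStructure_acLevelStructure_eq_bot_of_mem_of_ne [NeZero n] (hperf : inv.IsPerfect)
    (hn : ∀ P : W.geomTorsion ((p ^ k : ℕ) : ℤ), n • P = 0) {v : HeightOneSpectrum (𝓞 K)}
    (hv : ((p : ℕ) : 𝓞 K) ∈ v.asIdeal) (hne : v ≠ 𝔭) :
    inv.dualSelmerStructure (W.torsionGaloisModule ((p ^ k : ℕ) : ℤ))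
        (acLevelStructure W p k 𝔭 S) (Sum.inr v) = ⊥ := by
  rw [LocalInvariants.dualSelmerStructure_apply, acLevelStructure_eq_top_of_mem_of_ne W p k 𝔭 S hv hne]
  exact PoitouTateCounting.dualLocalCondition_top hperf _ hn v

/-- **`(𝓛^{(k)})^*_v = ⊥` at `v ∈ Σ`, `v ≠ 𝔭`** (perfect family, `n · E[p^k] = 0`).
[cite: Howard2004HeegnerKolyvagin, Def. 2.1.6 (arXiv:1202.6340 p. 5)] -/
theorem dualSelmerStructure_acLevelStructure_eq_bot_of_mem_S [NeZero n] (hperf : inv.IsPerfect)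
    (hn : ∀ P : W.geomTorsion ((p ^ k : ℕ) : ℤ), n • P = 0) {v : HeightOneSpectrum (𝓞 K)}
    (hvS : v ∈ S) (hne : v ≠ 𝔭) :
    inv.dualSelmerStructure (W.torsionGaloisModule ((p ^ k : ℕ) : ℤ))
        (acLevelStructure W p k 𝔭 S) (Sum.inr v) = ⊥ := by
  rw [LocalInvariants.dualSelmerStructure_apply, acLevelStructure_eq_top_of_mem_S W p k 𝔭 S hvS hne]
  exact PoitouTateCounting.dualLocalCondition_top hperf _ hn v

/-- At a complex place every dual condition is `⊤` (and `⊥`): `H¹(K_w, M^D) = 0`.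
[cite: GreenbergLNM1716, §3 p. 87] -/
theorem dualSelmerStructure_acLevelStructure_inl_eq_top_of_isComplex {w : InfinitePlace K}
    (hw : w.IsComplex) :
    inv.dualSelmerStructure (W.torsionGaloisModule ((p ^ k : ℕ) : ℤ))
        (acLevelStructure W p k 𝔭 S) (Sum.inl w) = ⊤ :=
  eq_top_of_isComplex _ hw _

end Summit.BirchSwinnertonDyer.Rank1Residual.X11b.AcSelmer

end
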